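import Summits.Ventures.PercRepro.GenQPairChoose

/-!
# PercRepro — the fundamental circuits of a coloop-free flat cover its basis (night-4, gen 3; sheet §49)

On a coloop-free flat `G` every basis point lies in the fundamental circuit of some point of `G ∖ B₀`
(`exists_mem_fc_of_mem_closure_erase`: otherwise `b ∈ cl(G ∖ b) ⊆ cl(B₀ ∖ b)`), so
`q ≤ Σ_x (#C_x − 1)` (`card_le_sum_card_fc`), and when all the circuits are `3`-circuits two distinct pairs of them
cannot both meet unless `q ≤ 2k − 2` (`card_biUnion_le_of_two_meets`, a counting lemma on families of `2`-sets).
These are the covering facts the type-`2` windows need beyond `q = 6` (the `k = 4` case of `(9, 7)`).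
-/

namespace PercRepro.GenQ

open Finset ThmH PerFlat SixFour ThmN

variable {α : Type*} [DecidableEq α] {M : Matroid α} [M.Finite]

/-! ## Every basis point of a coloop-free flat lies in a fundamental circuit -/

/-- **A basis point in the closure of the rest of `G` lies in the fundamental circuit of some point of `G ∖ B₀`**:
otherwise every `x ∈ G ∖ B₀` lies in `cl(C_x ∖ x) ⊆ cl(B₀ ∖ b)`, so `cl(G ∖ b) ⊆ cl(B₀ ∖ b) ∌ b`. -/
theorem exists_mem_fc_of_mem_closure_erase {G B₀ : Finset α} {q : ℕ} (hG : G ⊆ gr M)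
    (hrG : M.eRk (G : Set α) = (q : ℕ∞)) (hB : B₀ ∈ basesOf M G q) {b : α} (hb : b ∈ B₀)
    (hbcl : b ∈ M.closure ((G.erase b : Finset α) : Set α)) : ∃ x ∈ G \ B₀, b ∈ fc M x B₀ := by
  have hI := indep_of_mem_basesOf hB
  obtain ⟨hBG, _, _⟩ := mem_basesOf.1 hB
  by_contra hcon
  push Not at hcon
  have hsub : ((G.erase b : Finset α) : Set α) ⊆ M.closure ((B₀.erase b : Finset α) : Set α) := by
    intro e he
    rw [Finset.mem_coe, Finset.mem_erase] at he
    by_cases heB : e ∈ B₀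
    · exact M.subset_closure _ (by rw [← coe_gr M]; exact_mod_cast (Finset.erase_subset b B₀).trans (hBG.trans hG))
        (Finset.mem_coe.2 (Finset.mem_erase.2 ⟨he.1, heB⟩))
    · have hxK : e ∈ G \ B₀ := Finset.mem_sdiff.2 ⟨he.2, heB⟩
      have hC : M.IsCircuit ((fc M e B₀ : Finset α) : Set α) :=
        isCircuit_fc hI (mem_closure_of_mem_basesOf hG hrG hB he.2) heB
      have h1 := hC.mem_closure_sdiff_singleton_of_mem (Finset.mem_coe.2 (mem_fc_self e B₀))
      rw [← Finset.coe_erase] at h1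
      have h2 : ((fc M e B₀).erase e : Finset α) ⊆ B₀.erase b := by
        intro z hz
        rw [Finset.mem_erase] at hz
        rcases Finset.mem_insert.1 (fc_subset_insert e B₀ hz.2) with hze | hzB
        · exact absurd hze hz.1
        · exact Finset.mem_erase.2 ⟨fun h => hcon e hxK (h ▸ hz.2), hzB⟩
      exact M.closure_subset_closure (Finset.coe_subset.2 h2) h1
  have h3 := M.closure_subset_closure_of_subset_closure hsub hbcl
  have h4 : b ∉ M.closure ((B₀ : Set α) \ {b}) := hI.notMem_closure_sdiff_of_mem (Finset.mem_coe.2 hb)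
  rw [← Finset.coe_erase] at h4
  exact h4 h3

/-- A coloop-free set has every point in the closure of the rest (universe-polymorphic form of
`mem_closure_erase_of_mTr_eq_zero`). -/
theorem mem_closure_erase_of_mTr_eq_zero' {G : Finset α} (hm : mTr M G = 0) {a : α} (ha : a ∈ G) :
    a ∈ M.closure ((G.erase a : Finset α) : Set α) := by
  by_contra hacl
  have : a ∈ coloopsOf M G := mem_coloopsOf.2 ⟨ha, hacl⟩
  unfold mTr at hm
  rw [Finset.card_eq_zero] at hm
  rw [hm] at this
  exact Finset.notMem_empty a this

/-- **The covering count**: on a coloop-free flat, `q ≤ Σ_{x ∈ G ∖ B₀} (#C_x − 1)` (the sets `C_x ∖ x ⊆ B₀` cover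
`B₀`). -/
theorem card_le_sum_card_fc {G B₀ : Finset α} {q : ℕ} (hG : G ⊆ gr M) (hrG : M.eRk (G : Set α) = (q : ℕ∞))
    (hB : B₀ ∈ basesOf M G q) (hfree : mTr M G = 0) :
    q ≤ ∑ x ∈ G \ B₀, ((fc M x B₀).card - 1) := by
  obtain ⟨hBG, _, hc⟩ := mem_basesOf.1 hB
  have hcov : B₀ ⊆ (G \ B₀).biUnion (fun x => (fc M x B₀).erase x) := by
    intro b hb
    have hbcl : b ∈ M.closure ((G.erase b : Finset α) : Set α) :=
      mem_closure_erase_of_mTr_eq_zero' hfree (hBG hb)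
    obtain ⟨x, hx, hbx⟩ := exists_mem_fc_of_mem_closure_erase hG hrG hB hb hbcl
    rw [Finset.mem_biUnion]
    exact ⟨x, hx, Finset.mem_erase.2 ⟨fun h => (Finset.mem_sdiff.1 hx).2 (h ▸ hb), hbx⟩⟩
  calc q = B₀.card := hc.symm
    _ ≤ ((G \ B₀).biUnion (fun x => (fc M x B₀).erase x)).card := Finset.card_le_card hcov
    _ ≤ ∑ x ∈ G \ B₀, ((fc M x B₀).erase x).card := Finset.card_biUnion_le
    _ = ∑ x ∈ G \ B₀, ((fc M x B₀).card - 1) := by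
        apply Finset.sum_congr rfl
        intro x _
        rw [Finset.card_erase_of_mem (mem_fc_self x B₀)]

/-! ## Meeting pairs in a family of finsets -/

/-- **Two meeting pairs in a family of finsets**: if `P a` meets `P b` and `P a'` meets `P b'` with `a ≠ a'` and
`b, b' ∉ {a, a'}`, the union of the family over `K` has at most `Σ_x #(P x) − 2` points. -/
theorem card_biUnion_le_of_two_meets {K : Finset α} {P : α → Finset α} {a a' b b' : α} (ha : a ∈ K) (ha' : a' ∈ K)
    (hb : b ∈ K) (hb' : b' ∈ K) (haa' : a ≠ a') (hba : b ≠ a) (hba' : b ≠ a') (hb'a : b' ≠ a) (hb'a' : b' ≠ a')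
    (h1 : (P a ∩ P b).Nonempty) (h2 : (P a' ∩ P b').Nonempty) :
    (K.biUnion P).card + 2 ≤ ∑ x ∈ K, (P x).card := by
  set K' := (K.erase a).erase a' with hK'
  have ha'K : a' ∈ K.erase a := Finset.mem_erase.2 ⟨haa'.symm, ha'⟩
  have hsum : ∑ x ∈ K, (P x).card = ∑ x ∈ K', (P x).card + (P a').card + (P a).card := by
    rw [hK', Finset.sum_erase_add _ _ ha'K, Finset.sum_erase_add _ _ ha]
  have hbK' : b ∈ K' := Finset.mem_erase.2 ⟨hba', Finset.mem_erase.2 ⟨hba, hb⟩⟩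
  have hb'K' : b' ∈ K' := Finset.mem_erase.2 ⟨hb'a', Finset.mem_erase.2 ⟨hb'a, hb'⟩⟩
  have hsub : K.biUnion P ⊆ (K'.biUnion P ∪ (P a \ P b)) ∪ (P a' \ P b') := by
    intro e he
    rw [Finset.mem_biUnion] at he
    obtain ⟨x, hx, hex⟩ := he
    by_cases hxa : x = a
    · subst hxa
      by_cases heb : e ∈ P b
      · exact Finset.mem_union.2 (Or.inl (Finset.mem_union.2 (Or.inl (Finset.mem_biUnion.2 ⟨b, hbK', heb⟩))))
      · exact Finset.mem_union.2 (Or.inl (Finset.mem_union.2 (Or.inr (Finset.mem_sdiff.2 ⟨hex, heb⟩))))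
    by_cases hxa' : x = a'
    · subst hxa'
      by_cases heb' : e ∈ P b'
      · exact Finset.mem_union.2 (Or.inl (Finset.mem_union.2 (Or.inl (Finset.mem_biUnion.2 ⟨b', hb'K', heb'⟩))))
      · exact Finset.mem_union.2 (Or.inr (Finset.mem_sdiff.2 ⟨hex, heb'⟩))
    · exact Finset.mem_union.2 (Or.inl (Finset.mem_union.2 (Or.inl (Finset.mem_biUnion.2
        ⟨x, Finset.mem_erase.2 ⟨hxa', Finset.mem_erase.2 ⟨hxa, hx⟩⟩, hex⟩))))
  have h3 : (P a \ P b).card + 1 ≤ (P a).card := by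
    have := Finset.card_sdiff_add_card_inter (P a) (P b)
    have := Finset.card_pos.2 h1
    omega
  have h4 : (P a' \ P b').card + 1 ≤ (P a').card := by
    have := Finset.card_sdiff_add_card_inter (P a') (P b')
    have := Finset.card_pos.2 h2
    omega
  have h5 : (K'.biUnion P).card ≤ ∑ x ∈ K', (P x).card := Finset.card_biUnion_le
  have h6 := Finset.card_le_card hsub
  have h7 := Finset.card_union_le (K'.biUnion P ∪ (P a \ P b)) (P a' \ P b')
  have h8 := Finset.card_union_le (K'.biUnion P) (P a \ P b)
  omega

/-- **One meeting pair in a family of finsets**: if `P a` meets `P b` with `a ≠ b`, the union of the family over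
`K` has at most `Σ_x #(P x) − 1` points. -/
theorem card_biUnion_le_of_one_meets {K : Finset α} {P : α → Finset α} {a b : α} (ha : a ∈ K) (hb : b ∈ K)
    (hba : b ≠ a) (h1 : (P a ∩ P b).Nonempty) : (K.biUnion P).card + 1 ≤ ∑ x ∈ K, (P x).card := by
  set K' := K.erase a with hK'
  have hsum : ∑ x ∈ K, (P x).card = ∑ x ∈ K', (P x).card + (P a).card := by
    rw [hK', Finset.sum_erase_add _ _ ha]
  have hbK' : b ∈ K' := Finset.mem_erase.2 ⟨hba, hb⟩
  have hsub : K.biUnion P ⊆ K'.biUnion P ∪ (P a \ P b) := by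
    intro e he
    rw [Finset.mem_biUnion] at he
    obtain ⟨x, hx, hex⟩ := he
    by_cases hxa : x = a
    · subst hxa
      by_cases heb : e ∈ P b
      · exact Finset.mem_union.2 (Or.inl (Finset.mem_biUnion.2 ⟨b, hbK', heb⟩))
      · exact Finset.mem_union.2 (Or.inr (Finset.mem_sdiff.2 ⟨hex, heb⟩))
    · exact Finset.mem_union.2 (Or.inl (Finset.mem_biUnion.2 ⟨x, Finset.mem_erase.2 ⟨hxa, hx⟩, hex⟩))
  have h3 : (P a \ P b).card + 1 ≤ (P a).card := by
    have := Finset.card_sdiff_add_card_inter (P a) (P b)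
    have := Finset.card_pos.2 h1
    omega
  have h5 : (K'.biUnion P).card ≤ ∑ x ∈ K', (P x).card := Finset.card_biUnion_le
  have h6 := Finset.card_le_card hsub
  have h8 := Finset.card_union_le (K'.biUnion P) (P a \ P b)
  omega

omit [M.Finite] in
/-- The trace `C_x ∖ x ⊆ B₀` of a fundamental circuit. -/
theorem fc_erase_subset {B₀ : Finset α} (x : α) : (fc M x B₀).erase x ⊆ B₀ := by
  intro z hz
  rw [Finset.mem_erase] at hz
  rcases Finset.mem_insert.1 (fc_subset_insert x B₀ hz.2) with hzx | hzB
  · exact absurd hzx hz.1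
  · exact hzB

/-- A pair `P` of points whose circuit traces `C_x ∖ x`, `C_y ∖ y` on `B₀` meet. -/
def MeetingPair (M : Matroid α) [M.Finite] (B₀ : Finset α) (P : Finset α) : Prop :=
  ∃ x ∈ P, ∃ y ∈ P, x ≠ y ∧ ((fc M x B₀).erase x ∩ (fc M y B₀).erase y).Nonempty

/-- `MeetingPair` is decidable. -/
noncomputable instance (B₀ P : Finset α) : Decidable (MeetingPair M B₀ P) := by
  unfold MeetingPair
  infer_instance

/-- The traces of a coloop-free flat cover `B₀`, and `Σ_x #(C_x ∖ x) = Σ_x (#C_x − 1)`. -/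
theorem traces_cover {G B₀ : Finset α} {q : ℕ} (hG : G ⊆ gr M) (hrG : M.eRk (G : Set α) = (q : ℕ∞))
    (hB : B₀ ∈ basesOf M G q) (hfree : mTr M G = 0) :
    q ≤ ((G \ B₀).biUnion (fun x => (fc M x B₀).erase x)).card ∧
      ∑ x ∈ G \ B₀, ((fc M x B₀).erase x).card = ∑ x ∈ G \ B₀, ((fc M x B₀).card - 1) := by
  obtain ⟨hBG, _, hc⟩ := mem_basesOf.1 hB
  have hcov : B₀ ⊆ (G \ B₀).biUnion (fun x => (fc M x B₀).erase x) := by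
    intro b hb
    have hbcl : b ∈ M.closure ((G.erase b : Finset α) : Set α) :=
      mem_closure_erase_of_mTr_eq_zero' hfree (hBG hb)
    obtain ⟨x, hx, hbx⟩ := exists_mem_fc_of_mem_closure_erase hG hrG hB hb hbcl
    rw [Finset.mem_biUnion]
    exact ⟨x, hx, Finset.mem_erase.2 ⟨fun h => (Finset.mem_sdiff.1 hx).2 (h ▸ hb), hbx⟩⟩
  refine ⟨by rw [← hc]; exact Finset.card_le_card hcov, ?_⟩
  apply Finset.sum_congr rfl
  intro x _
  rw [Finset.card_erase_of_mem (mem_fc_self x B₀)]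

/-- A meeting pair `P ∈ (G ∖ B₀).powersetCard 2` yields two points of `G ∖ B₀` with meeting traces. -/
theorem exists_of_meetingPair {K B₀ P : Finset α} (hP : P ∈ K.powersetCard 2) (h : MeetingPair M B₀ P) :
    ∃ x ∈ K, ∃ y ∈ K, x ≠ y ∧ P = {x, y} ∧ ((fc M x B₀).erase x ∩ (fc M y B₀).erase y).Nonempty := by
  obtain ⟨hPsub, hPc⟩ := Finset.mem_powersetCard.1 hP
  obtain ⟨x, hxP, y, hyP, hxy, hmeet⟩ := h
  refine ⟨x, hPsub hxP, y, hPsub hyP, hxy, ?_, hmeet⟩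
  symm
  apply Finset.eq_of_subset_of_card_le
  · intro z hz
    rcases Finset.mem_insert.1 hz with rfl | hz'
    · exact hxP
    · rw [Finset.mem_singleton] at hz'
      exact hz' ▸ hyP
  · rw [hPc, Finset.card_pair hxy]

/-- **No meeting pair** on a coloop-free flat with `Σ_x (#C_x − 1) ≤ q`: one meeting pair would leave the traces
covering at most `Σ_x (#C_x − 1) − 1 < q` points. -/
theorem meetingPairs_eq_empty {G B₀ : Finset α} {q : ℕ} (hG : G ⊆ gr M) (hrG : M.eRk (G : Set α) = (q : ℕ∞))
    (hB : B₀ ∈ basesOf M G q) (hfree : mTr M G = 0) (hS : ∑ x ∈ G \ B₀, ((fc M x B₀).card - 1) ≤ q) :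
    ((G \ B₀).powersetCard 2).filter (fun P => MeetingPair M B₀ P) = ∅ := by
  obtain ⟨hcov, hsum⟩ := traces_cover hG hrG hB hfree
  rw [Finset.eq_empty_iff_forall_notMem]
  intro P hP
  rw [Finset.mem_filter] at hP
  obtain ⟨x, hxK, y, hyK, hxy, _, hmeet⟩ := exists_of_meetingPair hP.1 hP.2
  have := card_biUnion_le_of_one_meets (P := fun x => (fc M x B₀).erase x) hxK hyK hxy.symm hmeet
  omega

/-- **At most one meeting pair** on a coloop-free flat with `Σ_x (#C_x − 1) ≤ q + 1`: two distinct meeting pairs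
would leave the traces covering at most `Σ_x (#C_x − 1) − 2 < q` points. -/
theorem card_meetingPairs_le_one {G B₀ : Finset α} {q : ℕ} (hG : G ⊆ gr M) (hrG : M.eRk (G : Set α) = (q : ℕ∞))
    (hB : B₀ ∈ basesOf M G q) (hfree : mTr M G = 0)
    (hS : ∑ x ∈ G \ B₀, ((fc M x B₀).card - 1) ≤ q + 1) :
    (((G \ B₀).powersetCard 2).filter (fun P => MeetingPair M B₀ P)).card ≤ 1 := by
  obtain ⟨hcov, hsum⟩ := traces_cover hG hrG hB hfree
  set K := G \ B₀ with hK
  rw [Finset.card_le_one]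
  intro P₁ hP₁ P₂ hP₂
  by_contra hne
  rw [Finset.mem_filter] at hP₁ hP₂
  obtain ⟨x, hxK, y, hyK, hxy, hP₁eq, hmeet₁⟩ := exists_of_meetingPair hP₁.1 hP₁.2
  obtain ⟨x', hx'K, y', hy'K, hxy', hP₂eq, hmeet₂⟩ := exists_of_meetingPair hP₂.1 hP₂.2
  have key : ∀ (a a' b b' : α), a ∈ K → a' ∈ K → b ∈ K → b' ∈ K → a ≠ a' → b ≠ a → b ≠ a' → b' ≠ a → b' ≠ a' →
      ((fc M a B₀).erase a ∩ (fc M b B₀).erase b).Nonempty →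
      ((fc M a' B₀).erase a' ∩ (fc M b' B₀).erase b').Nonempty → False := by
    intro a a' b b' ha ha' hb hb' haa' hba hba' hb'a hb'a' h1 h2
    have := card_biUnion_le_of_two_meets (P := fun x => (fc M x B₀).erase x) ha ha' hb hb' haa' hba hba' hb'a
      hb'a' h1 h2
    omega
  have hmeet₁' : ((fc M y B₀).erase y ∩ (fc M x B₀).erase x).Nonempty := by
    rw [Finset.inter_comm]; exact hmeet₁
  have hmeet₂' : ((fc M y' B₀).erase y' ∩ (fc M x' B₀).erase x').Nonempty := by
    rw [Finset.inter_comm]; exact hmeet₂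
  have hxP₁ : x ∈ P₁ := by rw [hP₁eq]; exact Finset.mem_insert_self x {y}
  have hyP₁ : y ∈ P₁ := by rw [hP₁eq]; exact Finset.mem_insert_of_mem (Finset.mem_singleton_self y)
  have hxP₂ : x' ∈ P₂ := by rw [hP₂eq]; exact Finset.mem_insert_self x' {y'}
  have hyP₂ : y' ∈ P₂ := by rw [hP₂eq]; exact Finset.mem_insert_of_mem (Finset.mem_singleton_self y')
  have hpairs_ne : ∀ {u v : α}, u ∈ P₁ → v ∈ P₁ → u ≠ v → u ∈ P₂ → v ∈ P₂ → False := by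
    intro u v hu hv huv hu' hv'
    apply hne
    have h1 : ({u, v} : Finset α) ⊆ P₁ := Finset.insert_subset hu (Finset.singleton_subset_iff.2 hv)
    have h2 : ({u, v} : Finset α) ⊆ P₂ := Finset.insert_subset hu' (Finset.singleton_subset_iff.2 hv')
    have e1 := Finset.eq_of_subset_of_card_le h1 (by rw [hP₁eq, Finset.card_pair hxy, Finset.card_pair huv])
    have e2 := Finset.eq_of_subset_of_card_le h2 (by rw [hP₂eq, Finset.card_pair hxy', Finset.card_pair huv])
    rw [← e1, ← e2]
  by_cases hx2 : x ∈ P₂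
  · rcases (show x = x' ∨ x = y' by
        rw [hP₂eq] at hx2
        rcases Finset.mem_insert.1 hx2 with h | h
        · exact Or.inl h
        · exact Or.inr (Finset.mem_singleton.1 h)) with hxx' | hxy'
    · subst hxx'
      have hyy' : y ≠ y' := fun h => hpairs_ne hxP₁ hyP₁ hxy hxP₂ (h ▸ hyP₂)
      exact key y y' x x hyK hy'K hxK hxK hyy' hxy hxy' hxy hxy' hmeet₁' hmeet₂'
    · subst hxy'
      have hyx' : y ≠ x' := fun h => hpairs_ne hxP₁ hyP₁ hxy hyP₂ (h ▸ hxP₂)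
      exact key y x' x x hyK hx'K hxK hxK hyx' hxy (Ne.symm hxy') hxy (Ne.symm hxy') hmeet₁' hmeet₂
  by_cases hy2 : y ∈ P₂
  · rcases (show y = x' ∨ y = y' by
        rw [hP₂eq] at hy2
        rcases Finset.mem_insert.1 hy2 with h | h
        · exact Or.inl h
        · exact Or.inr (Finset.mem_singleton.1 h)) with hyx' | hyy'
    · subst hyx'
      have hxy'' : x ≠ y' := fun h => hpairs_ne hxP₁ hyP₁ hxy (h ▸ hyP₂) hxP₂
      exact key x y' y y hxK hy'K hyK hyK hxy'' (Ne.symm hxy) hxy' (Ne.symm hxy) hxy' hmeet₁ hmeet₂'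
    · subst hyy'
      have hxx'' : x ≠ x' := fun h => hpairs_ne hxP₁ hyP₁ hxy (h ▸ hxP₂) hyP₂
      exact key x x' y y hxK hx'K hyK hyK hxx'' (Ne.symm hxy) (Ne.symm hxy') (Ne.symm hxy) (Ne.symm hxy')
        hmeet₁ hmeet₂
  · have hxx' : x ≠ x' := fun h => hx2 (h ▸ hxP₂)
    have hyx' : y ≠ x' := fun h => hy2 (h ▸ hxP₂)
    have hy'x : y' ≠ x := fun h => hx2 (h ▸ hyP₂)
    exact key x x' y y' hxK hx'K hyK hy'K hxx' (Ne.symm hxy) hyx' hy'x (Ne.symm hxy') hmeet₁ hmeet₂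

omit [M.Finite] in
/-- Disjoint traces `C_x ∖ x`, `C_y ∖ y` give `#(C_x ∪ C_y) = #C_x + #C_y`. -/
theorem card_union_fc_of_disjoint_traces {B₀ : Finset α} {x y : α} (hxB : x ∉ B₀) (hyB : y ∉ B₀) (hxy : x ≠ y)
    (h : ¬ ((fc M x B₀).erase x ∩ (fc M y B₀).erase y).Nonempty) :
    (fc M x B₀ ∪ fc M y B₀).card = (fc M x B₀).card + (fc M y B₀).card := by
  rw [Finset.not_nonempty_iff_eq_empty] at h
  have hdis : Disjoint (fc M x B₀) (fc M y B₀) := by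
    rw [Finset.disjoint_left]
    intro e hex hey
    have hexB : e ∈ B₀ := by
      rcases Finset.mem_insert.1 (fc_subset_insert x B₀ hex) with rfl | hB
      · exfalso
        rcases Finset.mem_insert.1 (fc_subset_insert y B₀ hey) with h' | h'
        · exact hxy h'
        · exact hxB h'
      · exact hB
    have hne_x : e ≠ x := fun h' => hxB (h' ▸ hexB)
    have hne_y : e ≠ y := fun h' => hyB (h' ▸ hexB)
    have : e ∈ (fc M x B₀).erase x ∩ (fc M y B₀).erase y :=
      Finset.mem_inter.2 ⟨Finset.mem_erase.2 ⟨hne_x, hex⟩, Finset.mem_erase.2 ⟨hne_y, hey⟩⟩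
    rw [h] at this
    exact Finset.notMem_empty e this
  exact Finset.card_union_of_disjoint hdis

end PercRepro.GenQ
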